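import Summits.ResolutionOfSingularities.ResolutionOfSingularities.Theorems.StallVertexForms
import HarnessLib

/-!
# StallVertexKernels — decomp-res node «StallVertex» (lens-5 g20), tree file 2/5 of the node

Content VERBATIM from the decomp-res lens-5 g20 file
`HOME/decomp-res-lens-5/g20/parts/StallVertex-g20-0349e14d.lean` (sha256 0349e14dd83eb816, 869 l;
the CLEARED pin — the lens's later rev 1 d60a69dd «stall rigidity» is a superset awaiting its own critic row;
HOME = run/shared/lean/pub/decomp-res).
Critic: CRITIC-LEDGER row 142 (CLEARED 2026-08-30T20:41:19Z, DECIDED +1: the STALL VERTEX LAW `stall_vertex` in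
kernel, hypothesis-free).  Split per the
critic's order (§1–§2 halved for the 400-line limit; the three BY-NAME theorems on
`MaxContactCut.DefectWalksDeep` moved to the wiring file).  Landed by
decomp-res writer g7 in the lens's namespace `…Theorems.StallVertex`; every file of the node is in the Theses cone
(the lens imports the in-cone
`DifferentialShade` for `ifp` / `muTilde`), so the located residual `NoVertexBoundSkewStalledTailsDeep` cannot be
imported by the route file: it is
booked by RE-LOCATING the existing aside 28122 `CFNoSkewJointTailsDeep` (EXACTLY ⟺ it, hypothesis-free:
`skew_iff_vertexBound`) — one aside, not two.

§2 `Vertex` (l. 264–560): Lemma A `ordZero_move_le_layer`, **THE STALL VERTEX LAW `stall_vertex`**,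
`stall_vertex_origin`, `ordZero_dirForm_eq_zero_iff`,
`lostMass`, `ordZero_dirForm_ne_zero_of_stall_pos` — Literature-grade kernel next to `PointBlowupIFPUnitProp4` /
`DifferentialShade`.  PROVED, 0 sorry.

[WRITER NOTE (decomp-res writer g7): file split only; namespace, opens, section variables and every declaration
exactly as in the lens (global `set_option` dropped).]

(Sources: KawanoueMatsuki2016 §4.1; Hauser2010; HauserPerlega2024; Moh1987; CossartPiltant2008; Giraud1975; Hironaka1964.)
-/

noncomputable section

open MvPolynomial Finset
open Literature.AlgebraicGeometry.Resolution
open Literature.AlgebraicGeometry.Resolution.Hauser2010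
open Literature.AlgebraicGeometry.Resolution.HauserPerlega2024
open Literature.Barriers.ResolutionOfSingularities
open Literature.AlgebraicGeometry.Resolution.PointBlowup
open Summit.ResolutionOfSingularities.ResolutionOfSingularities.Theses
open Summit.ResolutionOfSingularities.ResolutionOfSingularities.Theorems.TightDefectClasses
open Summit.ResolutionOfSingularities.ResolutionOfSingularities.Theorems.ProximityCut
open Summit.ResolutionOfSingularities.ResolutionOfSingularities.Theorems.ExitLaw
open Summit.ResolutionOfSingularities.ResolutionOfSingularities.Theorems.DifferentialShade

namespace Summit.ResolutionOfSingularities.ResolutionOfSingularities.Theorems.StallVertex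

/-! ## §2 The vertex inequality of a `μ̃`-stall -/

section Vertex

variable {σ : Type*} {K : Type*} [Field K] [Fintype σ] [DecidableEq σ] [DecidableEq K]

/-- `untopD 0 x ≤ r` when `x ≤ r` (as in `PointBlowupIFPUnitProp4`, private there). [folklore] -/
theorem untopD_le_of_le_coe {x : WithTop ℚ} {r : ℚ} (h : x ≤ (r : WithTop ℚ)) : x.untopD 0 ≤ r := by
  induction x using WithTop.recTopCoe with
  | top => exact absurd h (WithTop.not_top_le_coe r)
  | coe y => simpa using h

/-- `r ≤ untopD 0 x` when `r ≤ x ≠ ⊤`. [folklore] -/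
theorem le_untopD_of_coe_le {x : WithTop ℚ} {r : ℚ} (h : (r : WithTop ℚ) ≤ x) (hx : x ≠ ⊤) :
    r ≤ x.untopD 0 := by
  induction x using WithTop.recTopCoe with
  | top => exact absurd rfl hx
  | coe y => simpa using h

/-- `untopD 0` is monotone below a finite bound. [folklore] -/
theorem untopD_le_untopD {x y : WithTop ℚ} (h : x ≤ y) (hy : y ≠ ⊤) : x.untopD 0 ≤ y.untopD 0 := by
  induction y using WithTop.recTopCoe with
  | top => exact absurd rfl hy
  | coe z =>
    have h' := untopD_le_of_le_coe h
    simpa using h'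

/-- The YOUNG MASS LOST by the move `(j, b)`: `Σ_{i ∈ E_young, i = j ∨ b_i ≠ 0} μ_{P,D_i}` — the young components the
new point leaves (`b_i ≠ 0`) together with the chart's own component (re-born as the new exceptional divisor).
(Sources: KawanoueMatsuki2016, §4.1 (E_young and the invariant μ̃).) -/
noncomputable def lostMass (q : ℕ) (j : σ) (b : σ → K) (t : IFPState σ K) : ℚ :=
  ∑ i ∈ t.young with (i = j ∨ b i ≠ 0), (t.muPD q i).untopD 0

/-- **THE VERTEX INEQUALITY OF A STALL (the law).**  Let `t` be a corner state of the IFP unit at a point of `Sing`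
(levels `< q`, every non-zero carried generator of order at least its level), `J₀` a minimising index of `μ_P`
(`μ_P = ord₀ g₀ / a₀ < ⊤`, `g₀ = t.gen J₀`, `a₀ = q - |J₀|`, `d₀ = ord₀ g₀`), and `(j, b)` a
move (`b_j = 0`) at which
the differential shade does NOT drop: `μ̃(t) ≤ μ̃(t.step q j b)` (Kawanoue–Matsuki's «Case: μ̃ stays the
same»).  Then
the tangent cone of the minimiser is SINGULAR AT THE BLOWN-UP DIRECTION to the maximal order the young divisors allow:
`d₀ - a₀ · lostMass ≤ ord₀ (dirForm d₀ j b g₀) = mult_{[b;1_j]} {in(g₀) = 0}`.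
Since `a₀ μ_{P,D_i} ≤ ord_{u_i} in(g₀)`, dividing `in(g₀)` by the young monomial `∏ u_i^{ord_{u_i} in
g₀}` over the lost
components leaves a form `Ψ` with `mult_{[b;1_j]} Ψ ≥ deg Ψ`, i.e. **`Ψ` is a CONE WITH VERTEX the blown-up
direction** (a form has multiplicity `≤` its degree at any point, with equality iff it is a cone with that vertex).
Proof: Kawanoue–Matsuki's three inequalities of Prop. 4 (2) (`PointBlowupIFPUnitProp4.muTilde_step_le`: new
component `μ'_{D_j} ≥ μ_P - 1`, kept components keep, lost components and `D_j` cost at most their `u`-orders) with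
the Moh monomial bound of step (1) replaced by the SHARP layer bound `ordZero_move_le_layer`; the stall hypothesis
turns the slack of step (1) into the displayed lower bound.  This is the kernel shadow of K–M's mechanism «when `μ̃`
stays, the companion `Comp(ℛ)` (= `ℛ` with the monomial `∏ x_D^{μ_{P,D}}` stripped) acquires an element of
`μ_P`-value `1`, a new element of the leading generator system, and `σ` DROPS» (arXiv:1205.4556 pp. 16, 23–24: the
horizontal direction of the weaving, valid in ARBITRARY dimension). (Sources: KawanoueMatsuki2016, Proposition 4 (2)
and §4.1 «Case: μ̃ stays the same»; new in this elementary form.) -/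
theorem stall_vertex (q : ℕ) (j : σ) (b : σ → K) (hbj : b j = 0) (t : IFPState σ K)
    (hlev : ∀ J ∈ t.idx, J.degree < q)
    (hsing : ∀ J ∈ t.idx, t.gen J ≠ 0 → (((q - J.degree : ℕ) : ℕ∞)) ≤ ordZero (t.gen J))
    (hstall : t.muTilde q ≤ (t.step q j b).muTilde q)
    {J₀ : σ →₀ ℕ} (hJ₀ : J₀ ∈ t.idx) (hμ : t.muP q = levelRatio (ordZero (t.gen J₀)) (q - J₀.degree))
    {d₀ : ℕ} (hd₀ : ordZero (t.gen J₀) = d₀) :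
    (d₀ : ℚ) - (q - J₀.degree : ℕ) * lostMass q j b t ≤ ((ordZero (dirForm d₀ j b (t.gen J₀))).toNat : ℚ) := by
  classical
  set g₀ := t.gen J₀ with hg₀
  set a₀ : ℕ := q - J₀.degree with ha₀
  have hg₀ne : g₀ ≠ 0 := by
    intro h0
    rw [h0, ordZero_zero] at hd₀
    exact ENat.top_ne_coe _ hd₀
  have htop : t.muP q ≠ ⊤ := by
    rw [hμ, hd₀, levelRatio_natCast]; exact WithTop.coe_ne_top
  have ha₀pos : 0 < a₀ := by have := hlev J₀ hJ₀; omega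
  have had₀ : a₀ ≤ d₀ := by
    have := hsing J₀ hJ₀ hg₀ne
    rw [← hg₀, hd₀] at this
    exact_mod_cast this
  have ha₀q : (0 : ℚ) < a₀ := by exact_mod_cast ha₀pos
  -- μ_P = d₀ / a₀
  have hμval : t.muP q = (((d₀ : ℚ) / a₀ : ℚ) : WithTop ℚ) := by
    rw [hμ, hd₀]; rfl
  set m : ℚ := (d₀ : ℚ) / a₀ with hm
  have hma : m * a₀ = d₀ := by rw [hm]; exact div_mul_cancel₀ _ ha₀q.ne'
  have hratio : ∀ J ∈ t.idx, (m : WithTop ℚ) ≤ levelRatio (ordZero (t.gen J)) (q - J.degree) := by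
    intro J hJ
    rw [← hμval]
    exact Finset.inf_le hJ
  -- the transported state
  set t' := t.step q j b with ht'
  have hgen' : ∀ J, t'.gen J = PointBlowup.translate b (chartTransform (q - J.degree) j (t.gen J)) := fun J => rfl
  have hidx' : t'.idx = t.idx := rfl
  have hyoung' : t'.young = insert j (t.young.filter fun i => b i = 0) := rfl
  set Kept : Finset σ := (t.young.erase j).filter fun i => b i = 0 with hKept
  set ε : σ → ℕ := fun i => (divisorOrder i g₀).toNat with hε
  -- (1') THE LAYER BOUND in place of the Moh monomial: μ_P' ≤ ((d₀ - a₀) + n) / a₀, n = ord (dirForm)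
  set T := dirForm d₀ j b g₀ with hTdef
  have hTne : T ≠ 0 := dirForm_ne_zero j b hd₀
  set n : ℕ := (ordZero T).toNat with hn
  have hTn : ordZero T = n := (coe_toNat_ordZero hTne).symm
  have hg₀' : t'.gen J₀ = PointBlowup.translate b (chartTransform a₀ j g₀) := hgen' J₀
  have hA : ordZero (t'.gen J₀) ≤ ((d₀ - a₀ + n : ℕ) : ℕ∞) := by
    rw [hg₀', Nat.cast_add, ← hTn]
    exact ordZero_move_le_layer b hbj had₀ hd₀
  have hg₀'ne : t'.gen J₀ ≠ 0 := by
    intro h0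
    rw [h0, ordZero_zero, top_le_iff] at hA
    exact ENat.coe_ne_top _ hA
  set M : ℚ := ((d₀ : ℚ) - a₀ + n) / a₀ with hM
  have hMa : M * a₀ = (d₀ : ℚ) - a₀ + n := by rw [hM]; exact div_mul_cancel₀ _ ha₀q.ne'
  have hμ'le : t'.muP q ≤ ((M : ℚ) : WithTop ℚ) := by
    calc t'.muP q ≤ levelRatio (ordZero (t'.gen J₀)) (q - J₀.degree) := Finset.inf_le (hidx' ▸ hJ₀)
      _ ≤ levelRatio ((d₀ - a₀ + n : ℕ) : ℕ∞) a₀ := levelRatio_mono hA a₀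
      _ = ((((d₀ - a₀ + n : ℕ) : ℚ) / a₀ : ℚ) : WithTop ℚ) := levelRatio_natCast _ _
      _ = ((M : ℚ) : WithTop ℚ) := by rw [hM, Nat.cast_add, Nat.cast_sub had₀]
  have hμ'ne : t'.muP q ≠ ⊤ := ne_top_of_le_ne_top WithTop.coe_ne_top hμ'le
  obtain ⟨m', hm'⟩ := WithTop.ne_top_iff_exists.mp hμ'ne
  have hm'le : m' ≤ M := by
    have := hμ'le; rw [← hm'] at this; exact WithTop.coe_le_coe.mp this
  -- (2) μ_{P',D_j} ≥ m − 1 (as in Prop. 4 (2))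
  have hnew : ((m - 1 : ℚ) : WithTop ℚ) ≤ t'.muPD q j := by
    refine Finset.le_inf fun J hJ => ?_
    rw [hidx'] at hJ
    rw [hgen']
    by_cases hJ0 : t.gen J = 0
    · rw [hJ0, chartTransform_zero]
      unfold PointBlowup.translate PointBlowup.divisorOrder
      rw [map_zero, MvPolynomial.support_zero, Finset.inf_empty, levelRatio_top]
      exact le_top
    obtain ⟨dJ, hdJ⟩ := exists_ordZero_eq_natCast hJ0
    have haJ : q - J.degree ≤ dJ := by
      have := hsing J hJ hJ0; rw [hdJ] at this; exact_mod_cast this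
    have haJpos : (0 : ℚ) < (q - J.degree : ℕ) := by
      have := hlev J hJ; exact_mod_cast (by omega : 0 < q - J.degree)
    have h1 := le_divisorOrder_new b hbj (q - J.degree) (t.gen J)
    rw [hdJ, ENat.toNat_coe] at h1
    calc ((m - 1 : ℚ) : WithTop ℚ) ≤ ((((dJ - (q - J.degree) : ℕ) : ℚ) / (q - J.degree : ℕ) : ℚ) : WithTop ℚ) := by
          rw [WithTop.coe_le_coe]
          have hr := hratio J hJ
          rw [hdJ, levelRatio_natCast, WithTop.coe_le_coe] at hr
          rw [Nat.cast_sub haJ, sub_div, div_self (ne_of_gt haJpos)]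
          linarith
      _ = levelRatio ((dJ - (q - J.degree) : ℕ) : ℕ∞) (q - J.degree) := (levelRatio_natCast _ _).symm
      _ ≤ levelRatio (divisorOrder j (PointBlowup.translate b (chartTransform (q - J.degree) j (t.gen J)))) (q - J.degree) :=
          levelRatio_mono h1 _
  -- (3) kept components: μ_{P',D_i} ≥ μ_{P,D_i}
  have hkept : ∀ i ∈ Kept, t.muPD q i ≤ t'.muPD q i := by
    intro i hi
    have hij : i ≠ j := Finset.ne_of_mem_erase (Finset.mem_filter.mp hi).1
    have hbi : b i = 0 := (Finset.mem_filter.mp hi).2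
    refine Finset.le_inf fun J hJ => ?_
    rw [hidx'] at hJ
    rw [hgen']
    calc t.muPD q i ≤ levelRatio (divisorOrder i (t.gen J)) (q - J.degree) := Finset.inf_le hJ
      _ ≤ _ := levelRatio_mono (divisorOrder_le_divisorOrder_kept b hij hbi _ _) _
  -- finiteness
  have hPDfin : ∀ i, t.muPD q i ≤ (((ε i : ℚ) / a₀ : ℚ) : WithTop ℚ) := by
    intro i
    calc t.muPD q i ≤ levelRatio (divisorOrder i g₀) (q - J₀.degree) := Finset.inf_le hJ₀
      _ = _ := by rw [← ENat.coe_toNat (divisorOrder_ne_top (i := i) hg₀ne)]; exact levelRatio_natCast _ _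
  have hPD'fin : ∀ i, t'.muPD q i ≠ ⊤ := by
    intro i
    have h1 : t'.muPD q i ≤ levelRatio (divisorOrder i (t'.gen J₀)) (q - J₀.degree) := Finset.inf_le (hidx' ▸ hJ₀)
    rw [← ENat.coe_toNat (divisorOrder_ne_top (i := i) hg₀'ne), levelRatio_natCast] at h1
    exact ne_top_of_le_ne_top WithTop.coe_ne_top h1
  -- the numbers
  set u : σ → ℚ := fun i => (t.muPD q i).untopD 0 with hu
  set u' : σ → ℚ := fun i => (t'.muPD q i).untopD 0 with hu'
  have hu'j : m - 1 ≤ u' j := le_untopD_of_coe_le hnew (hPD'fin j)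
  have hu'kept : ∀ i ∈ Kept, u i ≤ u' i := fun i hi => untopD_le_untopD (hkept i hi) (hPD'fin i)
  -- unfold the two μ̃'s in the stall hypothesis
  have hμt : t.muTilde q = ((m - ∑ i ∈ t.young, u i : ℚ) : WithTop ℚ) := by
    unfold IFPState.muTilde; rw [hμval]; rfl
  have hμt' : t'.muTilde q = ((m' - ∑ i ∈ t'.young, u' i : ℚ) : WithTop ℚ) := by
    unfold IFPState.muTilde; rw [← hm']; rfl
  rw [hμt, hμt', WithTop.coe_le_coe] at hstall
  -- sums over young' and young
  have hsum' : u' j + ∑ i ∈ Kept, u' i ≤ ∑ i ∈ t'.young, u' i := by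
    have hj : j ∈ t'.young := IFPState.mem_young_step q j b t
    rw [← Finset.add_sum_erase _ _ hj, hyoung', Finset.erase_insert_eq_erase, hKept]
    have : (t.young.erase j).filter (fun i => b i = 0) = (t.young.filter fun i => b i = 0).erase j := by
      ext i; simp [Finset.mem_filter, Finset.mem_erase, and_assoc]
    rw [this]
  have hKeptEq : Kept = t.young.filter fun i => ¬ (i = j ∨ b i ≠ 0) := by
    ext i
    simp only [hKept, Finset.mem_filter, Finset.mem_erase, not_or, not_not]
    tauto
  have hsplit : ∑ i ∈ t.young, u i = lostMass q j b t + ∑ i ∈ Kept, u i := by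
    rw [hKeptEq, lostMass]
    exact (Finset.sum_filter_add_sum_filter_not t.young (fun i => i = j ∨ b i ≠ 0) u).symm
  have hKsum : ∑ i ∈ Kept, u i ≤ ∑ i ∈ Kept, u' i := Finset.sum_le_sum fun i hi => hu'kept i hi
  -- the chain of K–M inequalities, with the stall closing it
  have hfin : 2 * m - 1 - lostMass q j b t ≤ M := by
    linarith [hstall, hsum', hKsum, hu'j, hm'le, hsplit]
  have h1 : (2 * m - 1 - lostMass q j b t) * a₀ ≤ M * a₀ := mul_le_mul_of_nonneg_right hfin ha₀q.le
  show (d₀ : ℚ) - (a₀ : ℚ) * lostMass q j b t ≤ (n : ℚ)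
  linarith [h1, hma, hMa]

/-- **THE UNTRANSLATED VERTEX LAW (`b = 0`: the new point is the origin of the chart `u_j`).**  At a stall, EVERY
monomial `u^e` of the initial form of the minimiser `g₀` has the SAME `u_j`-exponent
`e_j = a₀ · [j ∈ E_young] · μ_{P,D_j}`; in particular `in(g₀)` is `u_j`-FREE when `u_j` is not a young component, and
is `u_j^{e_j} · (a form in the other variables)` in general — the tangent cone of the minimiser is the union of the
young hyperplane `{u_j = 0}` (with its full multiplicity) and a cone over the `u_j`-axis.  (Upper bound: `stall_vertex`
with `ord₀ dirForm ≤ d₀ - e_j`; lower bound: `a₀ μ_{P,D_j} ≤ ord_{u_j} g₀ ≤ e_j`, definition of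
`μ_{P,D}`.) (Sources: KawanoueMatsuki2016, §4.1; new.) -/
theorem stall_vertex_origin (q : ℕ) (j : σ) (b : σ → K) (hb : ∀ i, b i = 0) (t : IFPState σ K)
    (hlev : ∀ J ∈ t.idx, J.degree < q)
    (hsing : ∀ J ∈ t.idx, t.gen J ≠ 0 → (((q - J.degree : ℕ) : ℕ∞)) ≤ ordZero (t.gen J))
    (hstall : t.muTilde q ≤ (t.step q j b).muTilde q)
    {J₀ : σ →₀ ℕ} (hJ₀ : J₀ ∈ t.idx) (hμ : t.muP q = levelRatio (ordZero (t.gen J₀)) (q - J₀.degree))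
    {d₀ : ℕ} (hd₀ : ordZero (t.gen J₀) = d₀)
    {e : σ →₀ ℕ} (he : e ∈ (homogeneousComponent d₀ (t.gen J₀)).support) :
    ((e j : ℚ) ≤ (q - J₀.degree : ℕ) * (if j ∈ t.young then (t.muPD q j).untopD 0 else 0)) ∧
      ((q - J₀.degree : ℕ) * (t.muPD q j).untopD 0 ≤ (e j : ℚ)) := by
  classical
  have hg₀ne : t.gen J₀ ≠ 0 := by
    intro h0
    rw [h0, ordZero_zero] at hd₀
    exact ENat.top_ne_coe _ hd₀
  have ha₀pos : 0 < q - J₀.degree := by have := hlev J₀ hJ₀; omega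
  have ha₀q : (0 : ℚ) < (q - J₀.degree : ℕ) := by exact_mod_cast ha₀pos
  -- lower bound (definition of μ_{P,D_j})
  have heg : e ∈ (t.gen J₀).support := mem_support_of_mem_support_homogeneousComponent he
  have hPD : t.muPD q j ≤ ((((divisorOrder j (t.gen J₀)).toNat : ℚ) / (q - J₀.degree : ℕ) : ℚ) : WithTop ℚ) := by
    calc t.muPD q j ≤ levelRatio (divisorOrder j (t.gen J₀)) (q - J₀.degree) := Finset.inf_le hJ₀
      _ = _ := by rw [← ENat.coe_toNat (divisorOrder_ne_top (i := j) hg₀ne)]; exact levelRatio_natCast _ _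
  have hu_le : (t.muPD q j).untopD 0 ≤ ((divisorOrder j (t.gen J₀)).toNat : ℚ) / (q - J₀.degree : ℕ) :=
    untopD_le_of_le_coe hPD
  have hεe : ((divisorOrder j (t.gen J₀)).toNat : ℚ) ≤ e j := by
    exact_mod_cast toNat_divisorOrder_le_exponent (i := j) heg
  have hlow : ((q - J₀.degree : ℕ) : ℚ) * (t.muPD q j).untopD 0 ≤ (e j : ℚ) := by
    have h1 := mul_le_mul_of_nonneg_left hu_le ha₀q.le
    rw [mul_div_cancel₀ _ ha₀q.ne'] at h1
    linarith
  refine ⟨?_, hlow⟩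
  -- upper bound (the vertex inequality + the surviving monomial u^{e^})
  have hV := stall_vertex q j b (hb j) t hlev hsing hstall hJ₀ hμ hd₀
  have hTne : dirForm d₀ j b (t.gen J₀) ≠ 0 := dirForm_ne_zero j b hd₀
  have hn : ((ordZero (dirForm d₀ j b (t.gen J₀))).toNat : ℚ) ≤ ((d₀ - e j : ℕ) : ℚ) := by
    have h := ordZero_dirForm_origin_le hb j he
    rw [← coe_toNat_ordZero hTne] at h
    exact_mod_cast h
  have hejle : e j ≤ d₀ := by
    have h1 := degree_eq_of_mem_support_homogeneousComponent he
    have h2 : e j ≤ e.degree := by have := degree_eq_add_sum_erase j e; omega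
    omega
  rw [Nat.cast_sub hejle] at hn
  have hlost : lostMass q j b t = if j ∈ t.young then (t.muPD q j).untopD 0 else 0 := by
    unfold lostMass
    have hfilter : (t.young.filter fun i => i = j ∨ b i ≠ 0) = t.young.filter fun i => i = j := by
      ext i; simp [hb i]
    rw [hfilter, Finset.filter_eq' t.young j]
    split_ifs with hj
    · rw [Finset.sum_singleton]
    · rw [Finset.sum_empty]
  rw [hlost] at hV
  linarith

/-- `untopD 0` of a non-negative element is non-negative. [folklore] -/
theorem untopD_nonneg {x : WithTop ℚ} (h : (0 : WithTop ℚ) ≤ x) : 0 ≤ x.untopD 0 := by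
  induction x using WithTop.recTopCoe with
  | top => simp
  | coe z => simpa using h

omit [Fintype σ] in
/-- The lost young mass is at most the total young mass. (Sources: KawanoueMatsuki2016, §4.1.) -/
theorem lostMass_le_sum (q : ℕ) (j : σ) (b : σ → K) (t : IFPState σ K) :
    lostMass q j b t ≤ ∑ i ∈ t.young, (t.muPD q i).untopD 0 := by
  unfold lostMass
  exact Finset.sum_le_sum_of_subset_of_nonneg (Finset.filter_subset _ _)
    (fun i _ _ => untopD_nonneg (IFPState.muPD_nonneg q t i))

omit [Fintype σ] [DecidableEq σ] [DecidableEq K] in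
/-- `μ̃ = μ_P − Σ_young μ_{P,D}` unfolded at a minimiser. (Sources: KawanoueMatsuki2016, §4.1.) -/
theorem muTilde_eq_at (q : ℕ) (t : IFPState σ K) {J₀ : σ →₀ ℕ}
    (hμ : t.muP q = levelRatio (ordZero (t.gen J₀)) (q - J₀.degree)) {d₀ : ℕ} (hd₀ : ordZero (t.gen J₀) = d₀) :
    t.muTilde q = ((((d₀ : ℚ) / (q - J₀.degree : ℕ)) - ∑ i ∈ t.young, (t.muPD q i).untopD 0 : ℚ) : WithTop ℚ) := by
  unfold IFPState.muTilde
  rw [hμ, hd₀, levelRatio_natCast]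
  rfl

/-- **THE OFF-CONE KILL.**  At a stall with `μ̃ > 0` the new point lies ON the projectivised tangent cone of EVERY
minimiser's initial form: a move whose direction avoids the cone `{in(g₀) = 0}` (`ord₀ dirForm = 0`) would need
`d₀ ≤ a₀ · lostMass ≤ a₀ · Σ_young μ_{P,D} = d₀ − a₀ μ̃ < d₀`.  [new; cite:
KawanoueMatsuki2016, §4.1] [folklore] -/
theorem ordZero_dirForm_ne_zero_of_stall_pos (q : ℕ) (j : σ) (b : σ → K) (hbj : b j = 0) (t : IFPState σ K)
    (hlev : ∀ J ∈ t.idx, J.degree < q)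
    (hsing : ∀ J ∈ t.idx, t.gen J ≠ 0 → (((q - J.degree : ℕ) : ℕ∞)) ≤ ordZero (t.gen J))
    (hstall : t.muTilde q ≤ (t.step q j b).muTilde q) (hpos : (0 : WithTop ℚ) < t.muTilde q)
    {J₀ : σ →₀ ℕ} (hJ₀ : J₀ ∈ t.idx) (hμ : t.muP q = levelRatio (ordZero (t.gen J₀)) (q - J₀.degree))
    {d₀ : ℕ} (hd₀ : ordZero (t.gen J₀) = d₀) :
    ordZero (dirForm d₀ j b (t.gen J₀)) ≠ 0 := by
  intro h0
  have hV := stall_vertex q j b hbj t hlev hsing hstall hJ₀ hμ hd₀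
  rw [h0] at hV
  simp only [ENat.toNat_zero, Nat.cast_zero] at hV
  have ha₀pos : 0 < q - J₀.degree := by have := hlev J₀ hJ₀; omega
  have ha₀q : (0 : ℚ) < (q - J₀.degree : ℕ) := by exact_mod_cast ha₀pos
  have hL := lostMass_le_sum q j b t
  rw [muTilde_eq_at q t hμ hd₀, ← WithTop.coe_zero, WithTop.coe_lt_coe] at hpos
  have h1 : ((q - J₀.degree : ℕ) : ℚ) * ∑ i ∈ t.young, (t.muPD q i).untopD 0 < (d₀ : ℚ) := by
    have h2 : ∑ i ∈ t.young, (t.muPD q i).untopD 0 < (d₀ : ℚ) / (q - J₀.degree : ℕ) := by linarith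
    have h3 := (lt_div_iff₀ ha₀q).mp h2
    linarith
  nlinarith [hL, ha₀q, h1, hV]

end Vertex

end Summit.ResolutionOfSingularities.ResolutionOfSingularities.Theorems.StallVertex
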